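import Summits.SmoothPoincare4.SmoothPoincare4.Theorems.EntropyRungNoncompactShrinkerGapHeatVeryWeakNoncompactAux
import Summits.SmoothPoincare4.SmoothPoincare4.Theorems.EntropyRungNoncompactShrinkerGapHeatWeightedGreen
import Literature.Geometry.Riemannian.WeightedHeatFlowFromLinearHeat
import HarnessLib

/-!
# Coercivity of the ground-state transformed heat operator WITHOUT a lower bound on the potential
# (support item `EntropyRung.BakryEmeryLogSobolev`, stmt-SmoothPoincare4-16587)

Setting: `M` modelled on `ℝⁿ` (Hausdorff, second countable, `T₃`, Borel — NOT compact), `g` Riemannian with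
its Levi-Civita connection, `V` smooth (NO further assumption), `L = Δ_g − g⁻¹(dV, d·)` and its ground-state
conjugate `e^{-V/2} L e^{V/2} = Δ_g − Q_V`, `Q_V = ¼|∇V|² − ½Δ_gV`. For a general `V` the potential `Q_V`
is unbounded below, so the coercivity `Q ≥ 1` of the shrinker toolkit's Lions argument
(`energy_le_integral_mul_heatAdjoint_static`) is not available. It is replaced by the PERFECT SQUARE

  `∫ (−φ Δ_gφ + Q_V φ²) dV_g = ∫ |∇(e^{V/2}φ)|²_g e^{-V} dV_g ≥ 0`  (`φ ∈ C_c^∞`),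

which holds for every smooth `V`:

* `weightedLaplacian_conj` — the conjugation identity `L(e^{V/2}φ) = e^{V/2}(Δ_gφ − Q_V φ)` (pointwise;
  the algebra of `heatDrift_of_potential`, `WeightedHeatFlowFromLinearHeat.lean`);
* `integral_schrodingerForm_nonneg` — `0 ≤ ∫ (−φ Δ_gφ + Q_V φ²) dV_g` for `φ ∈ C_c^∞` (the weighted Green
  identity with compact support, `weightedGreen_left`);
* `energy_le_integral_mul_schrodingerAdjoint` — **the energy inequality of Lions' projection method for
  `𝒜φ = −∂ₛφ − Δ_gφ + (Q_V + 1)φ`**: for `φ` smooth on `M × ℝ`, vanishing off `K × ℝ` (`K` compact) and for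
  `s ≥ b`, `∫_{M×(a,b)} φ² ≤ ∫_{M×(a,b)} φ 𝒜φ` — with NO lower bound on `Q_V` (Trèves 1975, (41.7)).

This is the input that lets the heat semigroup of a complete weighted manifold be constructed by the
`L²` method for an ARBITRARY smooth weight `e^{-V}` (Bakry–Gentil–Ledoux 2014, §3.2.3, p. 142: the
generator is the Friedrichs extension of a NONNEGATIVE form). Everything is proved; no definitions.

## References

* [Treves1975] F. Trèves, *Basic Linear Partial Differential Equations* (1975), §41, (41.7), Lemma 41.2.
* [BakryGentilLedoux2014] D. Bakry, I. Gentil, M. Ledoux (2014), §3.2.3 (p. 142) and §1.15.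
-/

noncomputable section

set_option linter.dupNamespace false

open scoped Manifold ContDiff ENNReal NNReal Topology
open MeasureTheory Set Filter
open Literature.Geometry.Lorentzian Literature.Geometry.Riemannian

namespace Summit.SmoothPoincare4.SmoothPoincare4.Theorems.BakryEmeryComplete

open NoncompactShrinkerGapHeat

section Coercivity

variable {n : ℕ} {M : Type*} [TopologicalSpace M] [T2Space M] [SecondCountableTopology M]
  [ChartedSpace (EuclideanSpace ℝ (Fin n)) M] [IsManifold (𝓡 n) ∞ M] [T3Space M]
  [MeasurableSpace M] [BorelSpace M]
  {g : PseudoRiemannianMetric (𝓡 n) ∞ (EuclideanSpace ℝ (Fin n)) (TangentSpace (𝓡 n) : M → Type _)}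
  [g.HasLeviCivita]

omit [T2Space M] [SecondCountableTopology M] [T3Space M] [MeasurableSpace M] [BorelSpace M] in
/-- **The ground-state conjugation, pointwise**: for `φ` of class `C²` at `x` and `V` smooth,
`L(e^{V/2}φ)(x) = e^{V(x)/2} (Δ_gφ(x) − (¼|∇V|² − ½Δ_gV)(x) φ(x))`, `L = Δ_g − g⁻¹(dV, d·)`
(`Δ(e^{V/2}φ) = e^{V/2}Δφ + φΔe^{V/2} + 2g⁻¹(de^{V/2}, dφ)`, `Δe^{V/2} = e^{V/2}(¼|∇V|² + ½ΔV)`,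
`de^{V/2} = ½e^{V/2}dV`). [cite: BakryGentilLedoux2014, §1.15.7 (ground state transform)] -/
theorem weightedLaplacian_conj {V : M → ℝ} (hV : ContMDiff (𝓡 n) 𝓘(ℝ, ℝ) ∞ V) {φ : M → ℝ} {x : M}
    (hφ : ContMDiffAt (𝓡 n) 𝓘(ℝ, ℝ) 2 φ x) :
    g.dalembertian (fun y ↦ Real.exp (V y / 2) * φ y) x
        - g.innerDual x (mvfderiv (𝓡 n) V x).toLinearMap
          (mvfderiv (𝓡 n) (fun y ↦ Real.exp (V y / 2) * φ y) x).toLinearMap =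
      Real.exp (V x / 2) * (g.dalembertian φ x - (g.gradSq V x / 4 - g.dalembertian V x / 2) * φ x) := by
  have hV2 : ContMDiffAt (𝓡 n) 𝓘(ℝ, ℝ) 2 V x := (hV.of_le (WithTop.coe_le_coe.mpr le_top)).contMDiffAt
  have hVd : MDifferentiableAt (𝓡 n) 𝓘(ℝ, ℝ) V x := hV.mdifferentiableAt (by simp)
  have hφd : MDifferentiableAt (𝓡 n) 𝓘(ℝ, ℝ) φ x := hφ.mdifferentiableAt (by norm_num)
  have hζ : ContDiff ℝ 2 (fun t : ℝ ↦ Real.exp (t / 2)) := Real.contDiff_exp.comp (contDiff_id.div_const 2)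
  have hζ' : ∀ t : ℝ, HasDerivAt (fun t : ℝ ↦ Real.exp (t / 2)) (Real.exp (t / 2) / 2) t := by
    intro t
    have h1 : HasDerivAt (fun t : ℝ ↦ t / 2) (1 / 2) t := by simpa using (hasDerivAt_id t).div_const 2
    have h2 := h1.exp
    convert h2 using 1
    ring
  have hd1 : deriv (fun t : ℝ ↦ Real.exp (t / 2)) = fun t ↦ Real.exp (t / 2) / 2 :=
    funext fun t ↦ (hζ' t).deriv
  have hd2 : deriv (deriv fun t : ℝ ↦ Real.exp (t / 2)) (V x) = Real.exp (V x / 2) / 4 := by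
    rw [hd1]
    have h3 : HasDerivAt (fun t : ℝ ↦ Real.exp (t / 2) / 2) (Real.exp (V x / 2) / 2 / 2) (V x) :=
      (hζ' (V x)).div_const 2
    rw [h3.deriv]
    ring
  have hA : ContMDiffAt (𝓡 n) 𝓘(ℝ, ℝ) 2 (fun y ↦ Real.exp (V y / 2)) x := hζ.contDiffAt.comp_contMDiffAt hV2
  have hAd : MDifferentiableAt (𝓡 n) 𝓘(ℝ, ℝ) (fun y ↦ Real.exp (V y / 2)) x := hA.mdifferentiableAt (by norm_num)
  -- `Δ e^{V/2}` and `d e^{V/2}`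
  have hΔA : g.dalembertian (fun y ↦ Real.exp (V y / 2)) x =
      Real.exp (V x / 2) / 4 * g.gradSq V x + Real.exp (V x / 2) / 2 * g.dalembertian V x := by
    have h1 := g.dalembertian_real_comp (ζ := fun t : ℝ ↦ Real.exp (t / 2)) hV2 hζ.contDiffAt
    rw [show (fun y ↦ Real.exp (V y / 2)) = (fun t : ℝ ↦ Real.exp (t / 2)) ∘ V from rfl, h1, hd2, hd1]
    rfl
  have hdA : (mvfderiv (𝓡 n) (fun y ↦ Real.exp (V y / 2)) x : TangentSpace (𝓡 n) x →ₗ[ℝ] ℝ) =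
      (Real.exp (V x / 2) / 2) • (mvfderiv (𝓡 n) V x : TangentSpace (𝓡 n) x →ₗ[ℝ] ℝ) := by
    ext v
    simp only [ContinuousLinearMap.coe_coe, LinearMap.smul_apply, smul_eq_mul]
    exact mvfderiv_real_comp_apply (I := 𝓡 n) (hζ' (V x)) hVd v
  -- `Δ u` and `du` for `u = e^{V/2} φ`
  have hΔu := dalembertian_fun_mul g hA hφ
  have hdu : (mvfderiv (𝓡 n) (fun y ↦ Real.exp (V y / 2) * φ y) x : TangentSpace (𝓡 n) x →ₗ[ℝ] ℝ) =
      Real.exp (V x / 2) • (mvfderiv (𝓡 n) φ x : TangentSpace (𝓡 n) x →ₗ[ℝ] ℝ)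
        + (φ x * (Real.exp (V x / 2) / 2)) • (mvfderiv (𝓡 n) V x : TangentSpace (𝓡 n) x →ₗ[ℝ] ℝ) := by
    have hm := mvfderiv_fun_mul hAd hφd
    apply_fun (fun L : TangentSpace (𝓡 n) x →L[ℝ] ℝ ↦ (L : TangentSpace (𝓡 n) x →ₗ[ℝ] ℝ)) at hm
    rw [hm, ContinuousLinearMap.toLinearMap_add, ContinuousLinearMap.toLinearMap_smul,
      ContinuousLinearMap.toLinearMap_smul, hdA, smul_smul]
  have hgV : g.innerDual x (mvfderiv (𝓡 n) V x : TangentSpace (𝓡 n) x →ₗ[ℝ] ℝ)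
      (mvfderiv (𝓡 n) V x : TangentSpace (𝓡 n) x →ₗ[ℝ] ℝ) = g.gradSq V x := rfl
  have e1 : (mvfderiv (𝓡 n) V x).toLinearMap = (mvfderiv (𝓡 n) V x : TangentSpace (𝓡 n) x →ₗ[ℝ] ℝ) := rfl
  have e2 : (mvfderiv (𝓡 n) (fun y ↦ Real.exp (V y / 2) * φ y) x).toLinearMap =
      (mvfderiv (𝓡 n) (fun y ↦ Real.exp (V y / 2) * φ y) x : TangentSpace (𝓡 n) x →ₗ[ℝ] ℝ) := rfl
  rw [e1, e2, hΔu, hΔA, hdA, hdu, g.innerDual_add_right, g.innerDual_smul_right, g.innerDual_smul_right,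
    g.innerDual_smul_left, hgV, g.innerDual_comm x (mvfderiv (𝓡 n) V x : TangentSpace (𝓡 n) x →ₗ[ℝ] ℝ)
      (mvfderiv (𝓡 n) φ x : TangentSpace (𝓡 n) x →ₗ[ℝ] ℝ)]
  ring

/-- **The Schrödinger form of the ground-state transform is a perfect square**:
`0 ≤ ∫ (−φ Δ_gφ + Q_V φ²) dV_g` for `φ ∈ C_c^∞(M)` and every smooth `V`, `Q_V = ¼|∇V|² − ½ΔV`: with
`ζ = e^{V/2}φ ∈ C_c^∞`, `φ(Δφ − Q_Vφ) = ζ (Lζ) e^{-V}` pointwise (`weightedLaplacian_conj`) and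
`∫ ζ (Lζ) e^{-V} dV_g = −∫ |∇ζ|² e^{-V} dV_g ≤ 0` (`weightedGreen_left`). [cite: BakryGentilLedoux2014, §3.2.3 (p. 142)] -/
theorem integral_schrodingerForm_nonneg (hg : g.IsRiemannian) {V : M → ℝ} (hV : ContMDiff (𝓡 n) 𝓘(ℝ, ℝ) ∞ V)
    {φ : M → ℝ} (hφ : ContMDiff (𝓡 n) 𝓘(ℝ, ℝ) ∞ φ) (hφc : HasCompactSupport φ) :
    0 ≤ ∫ x, (-(φ x * g.laplaceBeltrami φ x) + (g.gradSq V x / 4 - g.dalembertian V x / 2) * φ x ^ 2)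
      ∂g.riemVolume := by
  have h1le : (1 : ℕ∞ω) ≤ (∞ : ℕ∞ω) := WithTop.coe_le_coe.mpr le_top
  have h2le : (2 : ℕ∞ω) ≤ (∞ : ℕ∞ω) := WithTop.coe_le_coe.mpr le_top
  set ζ : M → ℝ := fun y ↦ Real.exp (V y / 2) * φ y with hζdef
  have hE : ContMDiff (𝓡 n) 𝓘(ℝ, ℝ) ∞ (fun y ↦ Real.exp (V y / 2)) :=
    (contMDiff_iff_contDiff.2 Real.contDiff_exp).comp (hV.div_const 2)
  have hζ : ContMDiff (𝓡 n) 𝓘(ℝ, ℝ) ∞ ζ := hE.mul hφ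
  have hζc : HasCompactSupport ζ := hφc.mul_left
  -- the weighted Green identity for `a = b = ζ`
  have hG := weightedGreen_left hg (hζ.of_le h1le) hζc (hζ.of_le h2le) (hV.of_le h1le)
  -- pointwise: `ζ (Lζ) e^{-V} = φ (Δφ − Q_V φ)`
  have hpt : ∀ x, ζ x * (g.dalembertian ζ x
      - g.innerDual x (mvfderiv (𝓡 n) V x).toLinearMap (mvfderiv (𝓡 n) ζ x).toLinearMap) * Real.exp (-V x) =
      -(-(φ x * g.laplaceBeltrami φ x) + (g.gradSq V x / 4 - g.dalembertian V x / 2) * φ x ^ 2) := by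
    intro x
    have hφ2 : ContMDiffAt (𝓡 n) 𝓘(ℝ, ℝ) 2 φ x := (hφ.of_le h2le).contMDiffAt
    have h := weightedLaplacian_conj (g := g) hV hφ2
    simp only [hζdef] at h ⊢
    rw [h, PseudoRiemannianMetric.laplaceBeltrami_eq_dalembertian]
    have hee : Real.exp (V x / 2) * Real.exp (V x / 2) * Real.exp (-V x) = 1 := by
      rw [← Real.exp_add, ← Real.exp_add, show V x / 2 + V x / 2 + -V x = 0 by ring, Real.exp_zero]
    calc Real.exp (V x / 2) * φ x * (Real.exp (V x / 2) *
          (g.dalembertian φ x - (g.gradSq V x / 4 - g.dalembertian V x / 2) * φ x)) * Real.exp (-V x)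
        = (Real.exp (V x / 2) * Real.exp (V x / 2) * Real.exp (-V x)) *
            (φ x * (g.dalembertian φ x - (g.gradSq V x / 4 - g.dalembertian V x / 2) * φ x)) := by ring
      _ = _ := by rw [hee]; ring
  have heq : ∫ x, (-(φ x * g.laplaceBeltrami φ x) + (g.gradSq V x / 4 - g.dalembertian V x / 2) * φ x ^ 2)
        ∂g.riemVolume = ∫ x, g.innerDual x (mvfderiv (𝓡 n) ζ x).toLinearMap (mvfderiv (𝓡 n) ζ x).toLinearMap *
          Real.exp (-V x) ∂g.riemVolume := by
    have e1 : ∫ x, (-(φ x * g.laplaceBeltrami φ x) + (g.gradSq V x / 4 - g.dalembertian V x / 2) * φ x ^ 2)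
        ∂g.riemVolume = ∫ x, -(ζ x * (g.dalembertian ζ x
          - g.innerDual x (mvfderiv (𝓡 n) V x).toLinearMap (mvfderiv (𝓡 n) ζ x).toLinearMap) * Real.exp (-V x))
            ∂g.riemVolume := integral_congr_ae (Eventually.of_forall fun x ↦ by dsimp only; rw [hpt x, neg_neg])
    rw [e1, integral_neg, hG, neg_neg]
  rw [heq]
  exact integral_nonneg fun x ↦ mul_nonneg (g.innerDual_self_nonneg hg x _) (Real.exp_pos _).le

/-- **The energy inequality of Lions' projection method for the ground-state transformed heat operator,
without a lower bound on the potential** (Trèves 1975, (41.7), with the perfect square above): on a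
(non-compact) Riemannian manifold `(M, g)` modelled on `ℝⁿ`, for `V` smooth, `Q_V = ¼|∇V|² − ½ΔV`, `a < b`,
and every smooth `φ` on `M × ℝ` vanishing off `K × ℝ` (`K` compact) and for `s ≥ b`,
`∫_{M×(a,b)} φ² ≤ ∫_{M×(a,b)} φ (−∂ₛφ − Δ_gφ(·,s) + (Q_V + 1)φ)` (`∫ₐᵇ φ(−∂ₛφ) = ½φ(a)² ≥ 0`,
`∫ (−φΔφ + Q_Vφ²) dV_g ≥ 0` at each time by `integral_schrodingerForm_nonneg`, Fubini).
[cite: Treves1975, §41, (41.7) and Lemma 41.2] [cite: BakryGentilLedoux2014, §3.2.3 (p. 142)] -/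
theorem energy_le_integral_mul_schrodingerAdjoint (hg : g.IsRiemannian) {V : M → ℝ}
    (hV : ContMDiff (𝓡 n) 𝓘(ℝ, ℝ) ∞ V) {a b : ℝ} (hab : a < b) {K : Set M} (hK : IsCompact K)
    {φ : M × ℝ → ℝ} (hφ : ContMDiff ((𝓡 n).prod 𝓘(ℝ, ℝ)) 𝓘(ℝ, ℝ) ∞ φ)
    (hφK : ∀ p : M × ℝ, p.1 ∉ K → φ p = 0) (hφb : ∀ (x : M) (s : ℝ), b ≤ s → φ (x, s) = 0) :
    ∫ p in univ ×ˢ Ioo a b, φ p ^ 2 ∂g.riemVolume.prod (volume : Measure ℝ) ≤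
      ∫ p in univ ×ˢ Ioo a b, φ p * (-(deriv (fun s ↦ φ (p.1, s)) p.2) -
        g.laplaceBeltrami (fun x ↦ φ (x, p.2)) p.1
        + (g.gradSq V p.1 / 4 - g.dalembertian V p.1 / 2 + 1) * φ p) ∂g.riemVolume.prod (volume : Measure ℝ) := by
  haveI : LocallyCompactSpace M := ChartedSpace.locallyCompactSpace (EuclideanSpace ℝ (Fin n)) M
  set μ₀ : Measure M := g.riemVolume with hμ₀
  haveI : IsFiniteMeasureOnCompacts μ₀ := CarrilloNi2009_shrinkerLSI.isFiniteMeasureOnCompacts_riemVolume hg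
  have hfam : IsContMDiffFamilyOn ∞ (fun _ : ℝ ↦ g) univ := isContMDiffFamilyOn_const g univ
  set φt : M × ℝ → ℝ := fun p ↦ deriv (fun s ↦ φ (p.1, s)) p.2 with hφt
  set Δφ : M × ℝ → ℝ := fun p ↦ g.laplaceBeltrami (fun x ↦ φ (x, p.2)) p.1 with hΔφ
  set QV : M → ℝ := fun x ↦ g.gradSq V x / 4 - g.dalembertian V x / 2 with hQV
  have hQVc : Continuous QV := (((contMDiff_gradSq g hV).div_const 4).sub
    ((contMDiff_dalembertian g hV).div_const 2)).continuous
  have hφts : ContMDiff ((𝓡 n).prod 𝓘(ℝ, ℝ)) 𝓘(ℝ, ℝ) ∞ φt := contMDiff_deriv_time hφ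
  have hΔφs : ContMDiff ((𝓡 n).prod 𝓘(ℝ, ℝ)) 𝓘(ℝ, ℝ) ∞ Δφ := contMDiff_laplaceBeltrami_family hfam hφ
  -- the restricted product measure is a product
  set νt : Measure ℝ := (volume : Measure ℝ).restrict (Ioo a b) with hνt
  haveI : IsFiniteMeasure νt := ⟨by rw [hνt, Measure.restrict_apply_univ]; exact measure_Ioo_lt_top⟩
  have hπ : (μ₀.prod (volume : Measure ℝ)).restrict (univ ×ˢ Ioo a b) = μ₀.prod νt := by
    rw [hνt, ← Measure.prod_restrict, Measure.restrict_univ]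
  have hint : ∀ {F : M × ℝ → ℝ}, Continuous F → (∀ p : M × ℝ, p.1 ∉ K → F p = 0) →
      Integrable F (μ₀.prod νt) := fun hF hF0 ↦ by
    rw [← hπ]; exact integrableOn_strip_of_continuous_of_vanish hg hK hF hF0 a b
  -- decomposition of the integrand
  have hdec : ∀ p, φ p * (-(deriv (fun s ↦ φ (p.1, s)) p.2) -
      g.laplaceBeltrami (fun x ↦ φ (x, p.2)) p.1
      + (g.gradSq V p.1 / 4 - g.dalembertian V p.1 / 2 + 1) * φ p) =
      -(φ p * φt p) + (-(φ p * Δφ p) + QV p.1 * φ p ^ 2) + φ p ^ 2 := by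
    intro p; simp only [hφt, hΔφ, hQV]; ring
  rw [hπ]
  simp_rw [hdec]
  have hi1 : Integrable (fun p ↦ -(φ p * φt p)) (μ₀.prod νt) :=
    hint (hφ.continuous.mul hφts.continuous).neg fun p hp ↦ by rw [hφK p hp, zero_mul, neg_zero]
  have hi2 : Integrable (fun p ↦ -(φ p * Δφ p) + QV p.1 * φ p ^ 2) (μ₀.prod νt) :=
    hint ((hφ.continuous.mul hΔφs.continuous).neg.add ((hQVc.comp continuous_fst).mul (hφ.continuous.pow 2)))
      fun p hp ↦ by rw [hφK p hp]; ring
  have hi0 : Integrable (fun p ↦ φ p ^ 2) (μ₀.prod νt) :=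
    hint (hφ.continuous.pow 2) fun p hp ↦ by rw [hφK p hp]; ring
  -- (1) the time term is nonnegative: `∫ₐᵇ −φ ∂ₛφ ds = ½ φ(x, a)²`
  have h1 : 0 ≤ ∫ p, -(φ p * φt p) ∂μ₀.prod νt := by
    rw [integral_prod _ hi1]
    refine integral_nonneg fun x ↦ ?_
    dsimp only
    have hφx : ∀ s, HasDerivAt (fun s' ↦ φ (x, s')) (φt (x, s)) s := fun s ↦ hasDerivAt_time hφ x s
    have c2 : Continuous fun s ↦ φ (x, s) := (contDiff_slice_time hφ x).continuous
    have c4 : Continuous fun s ↦ φt (x, s) := (contDiff_slice_time hφts x).continuous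
    have hE : ∀ s, HasDerivAt (fun s' ↦ φ (x, s') ^ 2) (2 * φ (x, s) * φt (x, s)) s := by
      intro s
      have hsq : (fun s' ↦ φ (x, s') ^ 2) = fun s' ↦ φ (x, s') * φ (x, s') := funext fun s' ↦ by ring
      rw [hsq]
      exact ((hφx s).fun_mul (hφx s)).congr_deriv (by ring)
    have hcE : Continuous fun s ↦ 2 * φ (x, s) * φt (x, s) := (continuous_const.mul c2).mul c4
    have hFTC : ∫ s in a..b, 2 * φ (x, s) * φt (x, s) = 0 - φ (x, a) ^ 2 := by
      rw [intervalIntegral.integral_eq_sub_of_hasDerivAt (fun s _ ↦ hE s) (hcE.intervalIntegrable a b),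
        hφb x b le_rfl]
      ring
    have hI : ∀ (f : ℝ → ℝ), ∫ s, f s ∂νt = ∫ s in a..b, f s := fun f ↦ by
      rw [hνt, intervalIntegral.integral_of_le hab.le, integral_Ioc_eq_integral_Ioo]
    rw [hI]
    have heq : ∫ s in a..b, -(φ (x, s) * φt (x, s)) = (1 / 2) * φ (x, a) ^ 2 := by
      have : ∀ s, -(φ (x, s) * φt (x, s)) = -(1 / 2) * (2 * φ (x, s) * φt (x, s)) := fun s ↦ by ring
      simp_rw [this]
      rw [intervalIntegral.integral_const_mul, hFTC]
      ring
    rw [heq]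
    positivity
  -- (2) the Schrödinger term is nonnegative at each time (the perfect square)
  have h2 : 0 ≤ ∫ p, (-(φ p * Δφ p) + QV p.1 * φ p ^ 2) ∂μ₀.prod νt := by
    rw [integral_prod_symm _ hi2]
    refine integral_nonneg fun s ↦ ?_
    change (0 : ℝ) ≤ ∫ x, (-(φ (x, s) * Δφ (x, s)) + QV x * φ (x, s) ^ 2) ∂μ₀
    have hcs : HasCompactSupport fun x ↦ φ (x, s) :=
      HasCompactSupport.of_support_subset_isCompact hK fun x hx ↦ by
        by_contra hxK
        exact hx (hφK (x, s) hxK)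
    exact integral_schrodingerForm_nonneg hg hV (contMDiff_slice_space hφ s) hcs
  -- (3) assemble
  have hsum : ∫ p, -(φ p * φt p) + (-(φ p * Δφ p) + QV p.1 * φ p ^ 2) + φ p ^ 2 ∂μ₀.prod νt =
      (∫ p, -(φ p * φt p) ∂μ₀.prod νt) + (∫ p, (-(φ p * Δφ p) + QV p.1 * φ p ^ 2) ∂μ₀.prod νt)
        + ∫ p, φ p ^ 2 ∂μ₀.prod νt := by
    have hi12 : Integrable (fun p ↦ -(φ p * φt p) + (-(φ p * Δφ p) + QV p.1 * φ p ^ 2)) (μ₀.prod νt) :=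
      hi1.add hi2
    rw [integral_add hi12 hi0, integral_add hi1 hi2]
  rw [hsum]
  linarith

end Coercivity

end Summit.SmoothPoincare4.SmoothPoincare4.Theorems.BakryEmeryComplete

end
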